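import Literature.AnabelianGeometry.AbsoluteAnabelian.FreeProlCyclicEncoding
import Literature.AnabelianGeometry.AbsoluteAnabelian.AbsTopICuspInertiaOfPSC
import Literature.AnabelianGeometry.SemiGraphs.PSCRamificationProofs
import HarnessLib

/-!
# [AbsTopI] Lem. 4.5 sub-DAG at `CuspInertiaData.ofPSC G`: the `henc` hypothesis discharged

Proof-only companion (no definitions) of abc-iut-w5-d062's bridge file
`AbsTopICuspInertiaOfPSC.lean` (`plan/L4/SUBDAG-AbsTopI-Lem45.md`, rows B1/B4 at the one-vertex
pro-`l` PSC datum `Π_G = H_*`).  The bridge file reduces SUB-NODE B4 (`InertiaIffMaximalTotRam`, the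
[CombGC] Thm. 1.6 (i) characterisation of cusp inertia subgroups as read in [AbsTopI] Lem. 4.5 (iv))
to layer L3's NAMED predicate `SemiGraphs.PSCDatum.CuspidalEdgeLikeCharacterization` ([IUTchI] Rmk.
1.2.3 (iv)) MODULO the encoding hypothesis `henc` ("`≅ ℤ_l`" as `AbsTopII.IsFreeProSigmaCyclic {l}`
versus "closure of a cyclic subgroup, infinite").  Since a `PSCDatum` CARRIES `IsProSigma Σ Π_G` and
`Σ = {l}`, `henc` HOLDS for `H_*` compact Hausdorff totally disconnected
(`FreeProlCyclicEncoding`): this file records the `henc`-free forms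

* `CuspInertiaData.henc_ofPSC` — the hypothesis itself, from `G.proSigma` (and L3's
  `PSCDatum.prime_of_sigma_eq`);
* `CuspInertiaData.inertiaIffMaximalTotRam_ofPSC_of_cuspidalEdgeLikeCharacterization` — B4 at
  `ofPSC G` relative to L3's named predicate ONLY;
* `CuspInertiaData.inertiaProcyclic_ofPSC_of_cuspidalEdgeLikeCharacterization` — the "`≅ ℤ_l`" half
  of B1 at `ofPSC G` relative to the same named predicate (a cuspidal edge-like subgroup satisfies the
  printed condition, in particular is closed, topologically monogenic and infinite; [CombGC] Rmk.
  1.1.3 "`Π_e ≅ Ẑ^Σ`" is not carried by `PSCDatum`, so B1 is not asserted unconditionally).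

HONEST FRAMING: the named L3 predicate is consumed BY NAME (FACT policy), not restated or proved;
nothing here takes a side on [IUTchIII] Cor. 3.12; typed ≠ proved.
-/

noncomputable section

namespace Literature.AnabelianGeometry.AbsoluteAnabelian.FundamentalExtension

open Literature.AnabelianGeometry.SemiGraphs

universe u

variable {Hstar : Type u} [Group Hstar] [TopologicalSpace Hstar] (G : PSCDatum Hstar)

/-- For a PSC datum of pro-`Σ` type with `Σ = {l}`, `Π_G` is a pro-`l` group.
[cite: MochizukiCombGC2007, Def 1.1(ii) p.6] -/
theorem isProSigma_singleton_of_sigma_eq {l : ℕ} (hS : G.Sigma = {l}) : IsProSigma {l} Hstar :=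
  hS ▸ G.proSigma

variable [IsTopologicalGroup Hstar] [CompactSpace Hstar] [T2Space Hstar] [TotallyDisconnectedSpace Hstar]

/-- **The hypothesis `henc` of `CuspInertiaData.inertiaIffMaximalTotRam_ofPSC` HOLDS** for the
PSC-fundamental group `H_* = Π_G` of a datum with `Σ = {l}` (profinite: compact, Hausdorff, totally
disconnected): for every closed `A ⊆ H_*`, `IsFreeProSigmaCyclic {l} A` iff `A` is the closure of a
cyclic subgroup and infinite (`AbsTopII.isFreeProSigmaCyclic_singleton_iff_of_isProSigma`).
[cite: Mochizuki2012, IUTchI Rmk 1.2.3(iv) pp.41-42] -/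
theorem CuspInertiaData.henc_ofPSC {l : ℕ} (hS : G.Sigma = {l}) :
    ∀ A : Subgroup Hstar, IsClosed (A : Set Hstar) →
      (AbsTopII.IsFreeProSigmaCyclic {l} ↥A ↔
        (∃ a : Hstar, (Subgroup.zpowers a).topologicalClosure = A) ∧ (A : Set Hstar).Infinite) :=
  haveI : Fact l.Prime := ⟨G.prime_of_sigma_eq hS⟩
  AbsTopII.isFreeProSigmaCyclic_singleton_iff_forall_isClosed (isProSigma_singleton_of_sigma_eq G hS)

/-- **SUB-NODE B4 of the [AbsTopI] Lem. 4.5 sub-DAG at `ofPSC G`**, relative ONLY to layer L3's named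
predicate `PSCDatum.CuspidalEdgeLikeCharacterization G` ([IUTchI] Rmk. 1.2.3 (iv) = the corrected
[CombGC] Thm. 1.6 (i) characterisation): the cusp inertia subgroups of `H_*` are exactly the maximal
closed `I ≅ ℤ_l` (`IsFreeProSigmaCyclic {l}`) such that every characteristic open `J ≠ I·J` gives a
covering `J ⊆ I·J` totally ramified at some cusp — abc-iut-w5-d062's reduction with its encoding
hypothesis `henc` DISCHARGED.  Needs a cusp (`X` not proper).
[cite: Mochizuki2012, IUTchI Rmk 1.2.3(iv) pp.41-42] [cite: MochizukiAbsTopI2012, Lemma 4.5 (iv) p.54] -/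
theorem CuspInertiaData.inertiaIffMaximalTotRam_ofPSC_of_cuspidalEdgeLikeCharacterization {l : ℕ}
    (hS : G.Sigma = {l}) (hC : Nonempty G.graph.C) (h : G.CuspidalEdgeLikeCharacterization) :
    (CuspInertiaData.ofPSC G).InertiaIffMaximalTotRam l :=
  CuspInertiaData.inertiaIffMaximalTotRam_ofPSC G hS hC (CuspInertiaData.henc_ofPSC G hS) h

/-- **SUB-NODE B1 ("`I_x ≅ ℤ_l`") of the [AbsTopI] Lem. 4.5 sub-DAG at `ofPSC G`**, relative to layer
L3's named predicate `PSCDatum.CuspidalEdgeLikeCharacterization G`: every cusp inertia subgroup of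
`H_*` (a conjugate of some `Π_c`) is closed and free pro-`l`-cyclic — it satisfies the printed
condition of [IUTchI] Rmk. 1.2.3 (iv) (closed, topologically monogenic, infinite), hence
`IsFreeProSigmaCyclic {l}` by the encoding lemma.  ([CombGC] Rmk. 1.1.3 "`Π_e ≅ Ẑ^Σ`" itself is not a
field of `PSCDatum`; this is the form available from the cited characterisation.)
[cite: MochizukiCombGC2007, Rmk 1.1.3 p.7] [cite: MochizukiAbsTopI2012, Lemma 4.5 (iv) p.54] -/
theorem CuspInertiaData.inertiaProcyclic_ofPSC_of_cuspidalEdgeLikeCharacterization {l : ℕ}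
    (hS : G.Sigma = {l}) (h : G.CuspidalEdgeLikeCharacterization) :
    (CuspInertiaData.ofPSC G).InertiaProcyclic l := by
  intro I hI
  have hcusp : G.IsCuspidal I := (CuspInertiaData.mem_inertiaSet_ofPSC_iff G I).mp hI
  have hL3 := h l hS
  obtain ⟨⟨hc, hgen, hinf, -⟩, -⟩ := (hL3 I).mp hcusp
  exact ⟨hc, (CuspInertiaData.henc_ofPSC G hS I hc).mpr ⟨hgen, hinf⟩⟩

end Literature.AnabelianGeometry.AbsoluteAnabelian.FundamentalExtension

end
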